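import Literature.Analysis.OperatorTheory.YangMillsMatrixModelGroundStateUnique
import Literature.Analysis.OperatorTheory.YangMillsMatrixModelGroundStatePositivity
import Mathlib.MeasureTheory.Measure.Haar.InnerProductSpace
import HarnessLib

/-!
# Spatial symmetries of Lüscher's matrix-model Hamiltonian: transport of the eigenfunction clauses, invariance of the positive ground state

Topic `Literature/Analysis/OperatorTheory`; companion of `YangMillsMatrixModelGroundStateUnique.lean` (the positive `L²`-normalised invariant ground state of
`𝔥 = −½Δ + ¼Σ|x_i × x_j|²` on `ℝ⁹ = (ℝ³)³` is unique, `groundState_eq_of_pos`).  Besides the colour rotations (`x_{(i,a)} ↦ Σ_b M_{ab} x_{(i,b)}`), `𝔥` commutes with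
the LINEAR ISOMETRIES of `ℝ⁹` acting on the SPATIAL index `i` that preserve `V` and commute with the colour action — the hyperoctahedral symmetries of the
three links (permutations `x_i ↦ x_{π⁻¹ i}`, the parity `x ↦ −x`, …).  For such an isometry `S`:

* `laplacian_comp_linearIsometryEquiv` — `Δ(f ∘ S)(x) = (Δf)(Sx)` (trace of the Hessian in the orthonormal basis `S e_p`, `laplacian_eq_sum_fderiv_fderiv_onb`);
  `hApply_comp_of_potential` — `𝔥(f ∘ S) = (𝔥f) ∘ S` when `V ∘ S = V`; `isGaugeInv_comp_of_commute`; `integral_comp_linearIsometryEquiv` (Lebesgue measure is preserved);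
* ★ `groundState_comp_eq_self` — **a positive normalised invariant `C²` ground state with exponential decay is `S`-INVARIANT** (`ψ ∘ S` satisfies the same
  clauses, uniqueness);
* instances: `rowPermIso π` (`= LinearIsometryEquiv.piLpCongrLeft`, `(rowPermIso π y)_{(i,a)} = y_{(π⁻¹ i, a)}`): `luscherPotential_rowPerm`, `colourRotate_rowPerm`,
  ★ `groundState_rowPerm`; the parity `x ↦ −x`: `luscherPotential_neg`, `colourRotate_neg`, ★ `groundState_neg` (`ψ(−x) = ψ(x)`).

Used by the femto-universe line «polyakovlift» (crux `DressedRitz`, stmt-QuantumFields-20205, r6): the transplanted observables `χ_R f_{i+1}/f_0` inherit the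
spatial parities of `f_{i+1}` because `f_0` and `χ_R` are invariant.  Theorems only (the isometries are Mathlib's `piLpCongrLeft` / `neg`); no named facts.
## References
* [ReedSimonIV1978] M. Reed, B. Simon, *Methods of Modern Mathematical Physics IV*, Thm. XIII.47–48 (uniqueness of the ground state ⇒ invariance under symmetries).
* [LiebLoss2001] E. H. Lieb, M. Loss, *Analysis*, Thm. 11.8, Thm. 9.10.
* [Luscher1983] M. Lüscher, NPB 219 (1983) 233, §2 (cubic symmetry of the effective Hamiltonian).
-/

noncomputable section

open MeasureTheory Filter Topology
open scoped BigOperators Matrix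

namespace Literature.Analysis.OperatorTheory.YMMatrixModel

/-! ### 1. Transport of the clauses along a linear isometry -/

/-- `Δ(f ∘ S)(x) = (Δf)(S x)` for a linear isometry `S` of `ℝ⁹` and `f ∈ C²`. [cite: LiebLoss2001, Thm. 9.10] -/
theorem laplacian_comp_linearIsometryEquiv (S : ZM ≃ₗᵢ[ℝ] ZM) {f : ZM → ℝ} (hf : ContDiff ℝ 2 f) (x : ZM) :
    laplacian (fun y => f (S y)) x = laplacian f (S x) := by
  classical
  set b : OrthonormalBasis (Fin 3 × Fin 3) ℝ ZM := EuclideanSpace.basisFun (Fin 3 × Fin 3) ℝ with hb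
  have hfS : ContDiff ℝ 2 (fun y => f (S y)) := hf.comp S.toContinuousLinearEquiv.contDiff
  rw [laplacian_eq_sum_fderiv_fderiv_onb b hfS x, laplacian_eq_sum_fderiv_fderiv_onb (b.map S) hf (S x)]
  refine Finset.sum_congr rfl fun p _ => ?_
  have h := fderiv_fderiv_comp_clm (S.toContinuousLinearEquiv : ZM →L[ℝ] ZM) hf x (b p) (b p)
  simp only [ContinuousLinearEquiv.coe_coe, LinearIsometryEquiv.coe_toContinuousLinearEquiv] at h
  rw [h, OrthonormalBasis.map_apply]

/-- `𝔥(f ∘ S) = (𝔥f) ∘ S` when the isometry preserves the potential. [cite: Luscher1983, §2] -/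
theorem hApply_comp_of_potential (S : ZM ≃ₗᵢ[ℝ] ZM) (hV : ∀ y, luscherPotential (S y) = luscherPotential y) {f : ZM → ℝ}
    (hf : ContDiff ℝ 2 f) (x : ZM) : hApply (fun y => f (S y)) x = hApply f (S x) := by
  rw [hApply_def, hApply_def, laplacian_comp_linearIsometryEquiv S hf x, hV x]

/-- Colour invariance is transported when `S` commutes with the colour rotations. [cite: Luscher1983, §2] -/
theorem isGaugeInv_comp_of_commute (S : ZM ≃ₗᵢ[ℝ] ZM)
    (hcol : ∀ M : Matrix (Fin 3) (Fin 3) ℝ, M ∈ Matrix.specialOrthogonalGroup (Fin 3) ℝ → ∀ y, S (colourRotate M y) = colourRotate M (S y))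
    {f : ZM → ℝ} (hinv : IsGaugeInv f) : IsGaugeInv fun y => f (S y) :=
  fun M hM y => by simp only [hcol M hM y, hinv M hM]

/-- Lebesgue measure on `ℝ⁹` is invariant under linear isometries: `∫ f(Sy) dy = ∫ f`. [cite: LiebLoss2001, Thm. 9.10] -/
theorem integral_comp_linearIsometryEquiv (S : ZM ≃ₗᵢ[ℝ] ZM) (f : ZM → ℝ) : (∫ y, f (S y)) = ∫ y, f y :=
  (S.measurePreserving).integral_comp S.toHomeomorph.measurableEmbedding f

/-- ★ **The positive ground state is invariant under every potential-preserving, colour-commuting linear isometry.**  If `ψ ∈ C²` is colour-invariant,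
`𝔥ψ = physLevel 1·ψ`, `|ψ| ≤ Ce^{−‖x‖}`, `∫ψ² = 1` and `ψ > 0`, then `ψ(Sy) = ψ(y)` for all `y`. [cite: ReedSimonIV1978, Thm. XIII.47–48] [cite: Luscher1983, §2] -/
theorem groundState_comp_eq_self (S : ZM ≃ₗᵢ[ℝ] ZM) (hV : ∀ y, luscherPotential (S y) = luscherPotential y)
    (hcol : ∀ M : Matrix (Fin 3) (Fin 3) ℝ, M ∈ Matrix.specialOrthogonalGroup (Fin 3) ℝ → ∀ y, S (colourRotate M y) = colourRotate M (S y))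
    {ψ : ZM → ℝ} (hψ : ContDiff ℝ 2 ψ) (hinv : IsGaugeInv ψ) (heig : ∀ x, hApply ψ x = physLevel 1 * ψ x)
    (hdec : ∃ C : ℝ, ∀ x, |ψ x| ≤ C * Real.exp (-‖x‖)) (hnorm : ∫ x, ψ x * ψ x = (1 : ℝ)) (hpos : ∀ x, 0 < ψ x) :
    (fun y => ψ (S y)) = ψ := by
  refine groundState_eq_of_pos (hψ.comp S.toContinuousLinearEquiv.contDiff) hψ (isGaugeInv_comp_of_commute S hcol hinv) hinv
    (fun x => by rw [hApply_comp_of_potential S hV hψ x, heig]) heig ?_ hdec ?_ hnorm (fun x => hpos (S x)) hpos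
  · obtain ⟨C, hC⟩ := hdec
    exact ⟨C, fun x => by have h := hC (S x); rwa [LinearIsometryEquiv.norm_map] at h⟩
  · rw [integral_comp_linearIsometryEquiv S (fun y => ψ y * ψ y), hnorm]

/-! ### 2. Row permutations `x_i ↦ x_{π⁻¹ i}` -/

/-- Coordinates of the row permutation `piLpCongrLeft (π × id)`: `(S_π y)_{(i,a)} = y_{(π⁻¹ i, a)}`. [cite: Luscher1983, §2] -/
theorem rowPerm_apply (π : Equiv.Perm (Fin 3)) (y : ZM) (p : Fin 3 × Fin 3) :
    LinearIsometryEquiv.piLpCongrLeft 2 ℝ ℝ (π.prodCongr (Equiv.refl (Fin 3))) y p = y (π.symm p.1, p.2) := by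
  rw [LinearIsometryEquiv.piLpCongrLeft_apply, Equiv.piCongrLeft'_apply]
  rfl

/-- `colourVec (S_π y) i = colourVec y (π⁻¹ i)`. [cite: Luscher1983, §2] -/
theorem colourVec_rowPerm (π : Equiv.Perm (Fin 3)) (y : ZM) (i : Fin 3) :
    colourVec (LinearIsometryEquiv.piLpCongrLeft 2 ℝ ℝ (π.prodCongr (Equiv.refl (Fin 3))) y) i = colourVec y (π.symm i) := by
  funext a; exact rowPerm_apply π y (i, a)

/-- The potential is invariant under row permutations. [cite: Luscher1983, §2] -/
theorem luscherPotential_rowPerm (π : Equiv.Perm (Fin 3)) (y : ZM) :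
    luscherPotential (LinearIsometryEquiv.piLpCongrLeft 2 ℝ ℝ (π.prodCongr (Equiv.refl (Fin 3))) y) = luscherPotential y := by
  unfold luscherPotential
  simp only [colourVec_rowPerm]
  congr 1
  rw [show (∑ i : Fin 3, ∑ j : Fin 3, (colourVec y (π.symm i) ⨯₃ colourVec y (π.symm j)) ⬝ᵥ (colourVec y (π.symm i) ⨯₃ colourVec y (π.symm j))) =
      ∑ i : Fin 3, (fun i' => ∑ j : Fin 3, (colourVec y i' ⨯₃ colourVec y (π.symm j)) ⬝ᵥ (colourVec y i' ⨯₃ colourVec y (π.symm j))) (π.symm i) from rfl,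
    Equiv.sum_comp π.symm (fun i' => ∑ j : Fin 3, (colourVec y i' ⨯₃ colourVec y (π.symm j)) ⬝ᵥ (colourVec y i' ⨯₃ colourVec y (π.symm j)))]
  refine Finset.sum_congr rfl fun i _ => ?_
  exact Equiv.sum_comp π.symm (fun j' => (colourVec y i ⨯₃ colourVec y j') ⬝ᵥ (colourVec y i ⨯₃ colourVec y j'))

/-- Row permutations commute with colour rotations. [cite: Luscher1983, §2] -/
theorem colourRotate_rowPerm (M : Matrix (Fin 3) (Fin 3) ℝ) (π : Equiv.Perm (Fin 3)) (y : ZM) :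
    LinearIsometryEquiv.piLpCongrLeft 2 ℝ ℝ (π.prodCongr (Equiv.refl (Fin 3))) (colourRotate M y) =
      colourRotate M (LinearIsometryEquiv.piLpCongrLeft 2 ℝ ℝ (π.prodCongr (Equiv.refl (Fin 3))) y) := by
  ext p
  rw [rowPerm_apply, colourRotate_apply, colourRotate_apply]
  exact Finset.sum_congr rfl fun b _ => by rw [rowPerm_apply]

/-- ★ **The positive ground state is invariant under row permutations**: `ψ(S_π y) = ψ(y)`. [cite: Luscher1983, §2] [cite: ReedSimonIV1978, Thm. XIII.47–48] -/
theorem groundState_rowPerm (π : Equiv.Perm (Fin 3)) {ψ : ZM → ℝ} (hψ : ContDiff ℝ 2 ψ) (hinv : IsGaugeInv ψ)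
    (heig : ∀ x, hApply ψ x = physLevel 1 * ψ x) (hdec : ∃ C : ℝ, ∀ x, |ψ x| ≤ C * Real.exp (-‖x‖))
    (hnorm : ∫ x, ψ x * ψ x = (1 : ℝ)) (hpos : ∀ x, 0 < ψ x) (y : ZM) :
    ψ (LinearIsometryEquiv.piLpCongrLeft 2 ℝ ℝ (π.prodCongr (Equiv.refl (Fin 3))) y) = ψ y :=
  congrFun (groundState_comp_eq_self _ (luscherPotential_rowPerm π) (fun M _ y => colourRotate_rowPerm M π y) hψ hinv heig hdec hnorm hpos) y

/-! ### 3. The parity `x ↦ −x` -/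

/-- `colourVec (−y) i = −colourVec y i`. [cite: Luscher1983, §2] -/
theorem colourVec_neg (y : ZM) (i : Fin 3) : colourVec (-y) i = -colourVec y i := by
  funext a; rfl

/-- The potential is even. [cite: Luscher1983, §2] -/
theorem luscherPotential_neg (y : ZM) : luscherPotential (-y) = luscherPotential y := by
  unfold luscherPotential
  simp only [colourVec_neg]
  congr 1
  refine Finset.sum_congr rfl fun i _ => Finset.sum_congr rfl fun j _ => ?_
  have h : (-colourVec y i) ⨯₃ (-colourVec y j) = colourVec y i ⨯₃ colourVec y j := by
    rw [LinearMap.map_neg₂, LinearMap.map_neg, neg_neg]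
  rw [h]

/-- Colour rotations are odd-linear: `M·(−y) = −(M·y)`. [cite: Luscher1983, §2] -/
theorem colourRotate_neg (M : Matrix (Fin 3) (Fin 3) ℝ) (y : ZM) : colourRotate M (-y) = -colourRotate M y := by
  ext p
  rw [colourRotate_apply]
  show _ = -(colourRotate M y p)
  rw [colourRotate_apply, ← Finset.sum_neg_distrib]
  exact Finset.sum_congr rfl fun b _ => by rw [show (-y) (p.1, b) = -(y (p.1, b)) from rfl]; ring

/-- ★ **The positive ground state is even**: `ψ(−y) = ψ(y)`. [cite: Luscher1983, §2] [cite: ReedSimonIV1978, Thm. XIII.47–48] -/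
theorem groundState_neg {ψ : ZM → ℝ} (hψ : ContDiff ℝ 2 ψ) (hinv : IsGaugeInv ψ)
    (heig : ∀ x, hApply ψ x = physLevel 1 * ψ x) (hdec : ∃ C : ℝ, ∀ x, |ψ x| ≤ C * Real.exp (-‖x‖))
    (hnorm : ∫ x, ψ x * ψ x = (1 : ℝ)) (hpos : ∀ x, 0 < ψ x) (y : ZM) : ψ (-y) = ψ y := by
  have h := groundState_comp_eq_self (LinearIsometryEquiv.neg ℝ) (fun y => luscherPotential_neg y)
    (fun M _ y => by simp only [LinearIsometryEquiv.coe_neg]; exact (colourRotate_neg M y).symm) hψ hinv heig hdec hnorm hpos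
  have := congrFun h y
  simpa [LinearIsometryEquiv.coe_neg] using this

end Literature.Analysis.OperatorTheory.YMMatrixModel

end
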